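import Summits.AtomisticToContinuum.Crystallization.Theorems.OverbindingBudgetAffineFarFieldCellVoronoi
import Mathlib.Geometry.Euclidean.PerpBisector

/-!
# Overbinding budget — far-field Voronoi cells, part 27V «CellVoronoiSandwich»: LEDGER FEED and CHARTS

Route `OverbindingBudget`, crux `RobustDefectLimitWindows` (stmt-31280), line (2c), leaf SW♭(30),
part 27V.  ATLAS-FREE.  Companion of CellVoronoi (the sandwich certificate
`image_shellCell_subset_voronoiCell` / `voronoiCell_subset_image_shellCell`):
* the corollaries that turn a sandwiched Voronoi cell into the cell hypotheses of the ledger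
  `farField_ledger` (CellLedger) — `starConvex_voronoiCell` (`hKs`), `isCompact_voronoiCell_of_subset`
  (`hK`, from the outer inclusion), `volume_voronoiCell_pos` (`hvol`, from the inner inclusion and
  `det A ≠ 0`), `aedisjoint_voronoiCell` (`hd`: two cells meet inside the perpendicular bisector, a
  proper affine subspace, hence a null set);
* `conformal_of_near_isometry`: a chart with `‖A − λR‖ ≤ ελ` (`R` a linear isometry, `λ ≥ 0` the
  local dilation) has conformal distortion `m = 2ε + ε²` — the hypothesis `hB` of the certificate.
-/

namespace Summit.AtomisticToContinuum.Crystallization.Theorems.OverbindingBudgetAffineFarFieldCellVoronoiFeed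

noncomputable section

open Set MeasureTheory
open Literature.Barriers.AtomisticToContinuum (voronoiCell convex_voronoiCell isClosed_voronoiCell
  mem_voronoiCell_self)
open Summit.AtomisticToContinuum.Crystallization.Theorems.OverbindingBudgetAffineFarFieldCellAffine

local notation "E3" => EuclideanSpace ℝ (Fin 3)

/-! ## Corollaries feeding the ledger's cell hypotheses -/

/-- support: Voronoi cells are star-convex about their centre. [this file] -/
theorem starConvex_voronoiCell (Z : Set E3) (y : E3) : StarConvex ℝ y (voronoiCell Z y) :=
  (convex_voronoiCell Z y).starConvex (mem_voronoiCell_self Z y)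

/-- support: a Voronoi cell inside a chart image of a compact template is compact. [this file] -/
theorem isCompact_voronoiCell_of_subset {Z : Set E3} {y : E3} {A : E3 ≃L[ℝ] E3} {K' : Set E3}
    (hK' : IsCompact K') (h : voronoiCell Z y ⊆ affMap 0 y A '' K') : IsCompact (voronoiCell Z y) :=
  (hK'.image (continuous_affMap 0 y A)).of_isClosed_subset (isClosed_voronoiCell Z y) h

/-- support: a chart has non-zero determinant. [this file] -/
theorem det_coe_ne_zero (A : E3 ≃L[ℝ] E3) : (A : E3 →L[ℝ] E3).det ≠ 0 :=
  A.toLinearEquiv.isUnit_det'.ne_zero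

/-- support: a compact Voronoi cell containing a chart image of a template of positive volume has
positive (finite) volume. [this file] -/
theorem volume_voronoiCell_pos {Z : Set E3} {y : E3} {A : E3 ≃L[ℝ] E3} {K' : Set E3}
    (hc : IsCompact (voronoiCell Z y)) (hK' : MeasurableSet K') (hpos : 0 < (volume K').toReal)
    (h : affMap 0 y A '' K' ⊆ voronoiCell Z y) : 0 < (volume (voronoiCell Z y)).toReal := by
  have h1 : 0 < (volume (affMap 0 y A '' K')).toReal := by
    rw [volume_image_affMap_toReal 0 y A hK']
    exact mul_pos (abs_pos.2 (det_coe_ne_zero A)) hpos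
  have h2 : 0 < volume (affMap 0 y A '' K') := (ENNReal.toReal_pos_iff.1 h1).1
  exact ENNReal.toReal_pos (h2.trans_le (measure_mono h)).ne' hc.measure_lt_top.ne

/-- support: the Voronoi cells of two distinct atoms are a.e.-disjoint (they meet inside the
perpendicular bisector, a proper affine subspace, hence a null set). [this file] -/
theorem aedisjoint_voronoiCell {Z : Set E3} {y y' : E3} (hy : y ∈ Z) (hy' : y' ∈ Z) (hne : y ≠ y') :
    AEDisjoint volume (voronoiCell Z y) (voronoiCell Z y') := by
  have hsub : voronoiCell Z y ∩ voronoiCell Z y' ⊆ (AffineSubspace.perpBisector y y' : Set E3) := by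
    rintro x ⟨hx, hx'⟩
    rw [SetLike.mem_coe, AffineSubspace.mem_perpBisector_iff_dist_eq]
    exact le_antisymm (hx y' hy') (hx' y hy)
  have hne' : AffineSubspace.perpBisector y y' ≠ ⊤ := by
    rwa [Ne, AffineSubspace.perpBisector_eq_top]
  exact measure_mono_null hsub (Measure.addHaar_affineSubspace volume _ hne')

/-! ## From a near-isometry to the conformal distortion bound -/

/-- support: if `‖A − λR‖ ≤ ελ` for a linear isometry `R` and `λ ≥ 0`, then `A` has conformal
distortion `m = 2ε + ε²` at dilation `λ`: `|⟪Au, Aw⟫ − λ²⟪u, w⟫| ≤ (2ε + ε²)λ²‖u‖‖w‖`. [this file] -/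
theorem conformal_of_near_isometry (A : E3 ≃L[ℝ] E3) (R : E3 ≃ₗᵢ[ℝ] E3) {lam ε : ℝ} (hlam : 0 ≤ lam)
    (hε : 0 ≤ ε)
    (hA : ‖(A : E3 →L[ℝ] E3) - lam • R.toLinearIsometry.toContinuousLinearMap‖ ≤ ε * lam)
    (u w : E3) :
    |inner ℝ (A u) (A w) - lam ^ 2 * inner ℝ u w| ≤ (2 * ε + ε ^ 2) * lam ^ 2 * ‖u‖ * ‖w‖ := by
  set E : E3 →L[ℝ] E3 := (A : E3 →L[ℝ] E3) - lam • R.toLinearIsometry.toContinuousLinearMap with hE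
  have hAu : (A : E3 →L[ℝ] E3) u = lam • R u + E u := by
    change _ = _ + ((A : E3 →L[ℝ] E3) u - lam • R u)
    abel
  have hAw : (A : E3 →L[ℝ] E3) w = lam • R w + E w := by
    change _ = _ + ((A : E3 →L[ℝ] E3) w - lam • R w)
    abel
  have hRR : inner ℝ (R u) (R w) = inner ℝ u w := R.inner_map_map u w
  have hsplit : inner ℝ (A u) (A w) - lam ^ 2 * inner ℝ u w
      = lam * inner ℝ (R u) (E w) + lam * inner ℝ (E u) (R w) + inner ℝ (E u) (E w) := by
    rw [show inner ℝ (A u) (A w) = inner ℝ ((A : E3 →L[ℝ] E3) u) ((A : E3 →L[ℝ] E3) w) from rfl,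
      hAu, hAw, inner_add_left, inner_add_right, inner_add_right, real_inner_smul_left,
      real_inner_smul_right, real_inner_smul_left, real_inner_smul_right, hRR]
    ring
  have hEu : ‖E u‖ ≤ ε * lam * ‖u‖ := (E.le_opNorm u).trans (mul_le_mul_of_nonneg_right hA (norm_nonneg _))
  have hEw : ‖E w‖ ≤ ε * lam * ‖w‖ := (E.le_opNorm w).trans (mul_le_mul_of_nonneg_right hA (norm_nonneg _))
  have h1 : |inner ℝ (R u) (E w)| ≤ ‖u‖ * (ε * lam * ‖w‖) := by
    refine (abs_real_inner_le_norm _ _).trans ?_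
    rw [R.norm_map]
    exact mul_le_mul_of_nonneg_left hEw (norm_nonneg _)
  have h2 : |inner ℝ (E u) (R w)| ≤ ε * lam * ‖u‖ * ‖w‖ := by
    refine (abs_real_inner_le_norm _ _).trans ?_
    rw [R.norm_map]
    exact mul_le_mul_of_nonneg_right hEu (norm_nonneg _)
  have h3 : |inner ℝ (E u) (E w)| ≤ ε * lam * ‖u‖ * (ε * lam * ‖w‖) :=
    (abs_real_inner_le_norm _ _).trans (mul_le_mul hEu hEw (norm_nonneg _) (by positivity))
  rw [hsplit]
  have hl : |lam| = lam := abs_of_nonneg hlam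
  calc |lam * inner ℝ (R u) (E w) + lam * inner ℝ (E u) (R w) + inner ℝ (E u) (E w)|
      ≤ |lam * inner ℝ (R u) (E w)| + |lam * inner ℝ (E u) (R w)| + |inner ℝ (E u) (E w)| :=
        (abs_add_le _ _).trans (add_le_add (abs_add_le _ _) le_rfl)
    _ = lam * |inner ℝ (R u) (E w)| + lam * |inner ℝ (E u) (R w)| + |inner ℝ (E u) (E w)| := by
        rw [abs_mul, abs_mul, hl]
    _ ≤ lam * (‖u‖ * (ε * lam * ‖w‖)) + lam * (ε * lam * ‖u‖ * ‖w‖)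
          + ε * lam * ‖u‖ * (ε * lam * ‖w‖) := by gcongr
    _ = (2 * ε + ε ^ 2) * lam ^ 2 * ‖u‖ * ‖w‖ := by ring

end

end Summit.AtomisticToContinuum.Crystallization.Theorems.OverbindingBudgetAffineFarFieldCellVoronoiFeed
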